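import Literature.NumberTheory.PAdicHodge.BmaxPlusBdRModFilPeriods
import Literature.NumberTheory.PAdicHodge.BdRPlusFormalLogXiAdic
import Literature.NumberTheory.PAdicHodge.AinfWeierstrassDivisionLift
import HarnessLib

/-!
# The `A_max`-period of a torsion sequence maps to `p^N · ∫_v ω` modulo `Fil^k`

Topic `Literature/NumberTheory/PAdicHodge`; namespace `Literature.NumberTheory.PAdicHodge.AinfTop`. THEOREMS ONLY (no definition, no named
fact, no instance, no `sorry`). The identification, under the comparison `B_max⁺ → B_dR⁺/Fil^k` (`BmaxPlusBdRModFil`), of the φ-road's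
`A_max`-periods `L_v = Λ_N(ι[ṽ], z) = p^N·log_W(ι[ṽ])` of TORSION sequences `v ∈ T_pŴ(𝒪_{ℂ_F})` (`v₀ = 0`; `BmaxPlusFormalLogDivisionTower`,
`BmaxPlusFormalLogPeriodMap`) with the LEAD chain's honest `ξ`-adic `ω`-periods `∫_v ω ∈ Fil¹ B_dR⁺` (K1, `AinfWeierstrassOmegaPeriod.omegaPeriod`):

* `thetaPt_divisionLiftPt_eq_zero` — `θ[ṽ] = 0` for a torsion sequence;
* ★★ `sub_pow_mul_omegaPeriod_mem_of_bdR_lim_modFil_logSum` — **every limit `L` of `Λ_N(ι[ṽ], z)` modulo `Fil^k` satisfies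
  `L − p^N·∫_v ω ∈ ξ^k B_dR⁺`**: `L = p^N·L′` with `L′` a value of `log_W(ι[ṽ])` modulo `Fil^k` (`exists_isFormalLogModFil_of_bdR_lim_modFil_logSum`,
  B5b), K1's `logKer [ṽ] = ∫_v ω` is another such value (`isFormalLogModFil_logKer`, `logKer_divisionLiftPt_of_zero`), and values are unique modulo
  `Fil^k` (`IsFormalLogModFil.sub_mem_span_xiBdR_pow`).

So on the Tate module the φ-road's `Pω` IS the socket's `∫ ω` (up to the normalisation `p^N` and `Fil^k`): brick B8 of line `kato_lever` can take
`Pω := omegaPeriodHom` (crux K★ `stmt-BirchSwinnertonDyer-22226`, memo `Summits/…/Cruxes/StarredOptimalManinUnitFiveSeven/Lines/kato-lever-K2-phi-road.md`).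
Infrastructure only; BSD / K★ are not proved by any of this.

## References
* J.-M. Fontaine, *Formes différentielles et modules de Tate…*, Invent. Math. 65 (1982), §5. [Fontaine1982FormesDifferentielles]
* P. Colmez, *Périodes p-adiques des variétés abéliennes*, Math. Ann. 292 (1992), §2. [Colmez1992PeriodesAbeliennes]
* J.-M. Fontaine, *Le corps des périodes p-adiques*, Astérisque 223 (1994), Exp. II §1.5.3–1.5.4. [FontaineAsterisque223III]
-/

noncomputable section

open WittVector Field ValuativeRel
open Literature.AlgebraicGeometry.Resolution
open Literature.RingTheory.FormalGroups

namespace Literature.NumberTheory.PAdicHodge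

namespace AinfTop

open Literature.NumberTheory.GaloisRepresentations Literature.NumberTheory.GaloisRepresentations.IsNonarchimedeanLocalField
open Literature.NumberTheory.GaloisRepresentations.LubinTate Literature.NumberTheory.EllipticCurves
open GaloisContinuity

variable {F : Type} [Field F] [ValuativeRel F] [TopologicalSpace F] [IsNonarchimedeanLocalField F]
  [CharZero F] {p : ℕ} [Fact p.Prime] [Fact (¬ IsUnit (p : integerC F))]
  [IsAdicComplete (Ideal.span {(p : integerC F)}) (integerC F)]
  {hθ : Function.Surjective (fontaineTheta (integerC F) p)} (W : WeierstrassCurve ℤ)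

/-- **`θ[ṽ] = 0` for a torsion sequence** (`v₀ = 0`; `θ[ṽ] = v₀`, `thetaPt_divisionLiftPt`). [cite: FontaineAsterisque223III, Exp. II §1.2.2] -/
theorem thetaPt_divisionLiftPt_eq_zero {t : ℕ → (maxNilIdealC F).toIdeal} (ht0 : ((t 0 : (maxNilIdealC F).toIdeal) : CBall F) = 0)
    (htp : ∀ n, mulPC F p W (t (n + 1)) = t n) : thetaPt W hθ (divisionLiftPt W hθ t htp) = 0 := by
  rw [thetaPt_divisionLiftPt]
  exact WeierstrassCurve.Pt.ext (Subtype.ext (by rw [WeierstrassCurve.Pt.val_zero, ZeroMemClass.coe_zero]; exact ht0))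

set_option maxHeartbeats 1600000 in
/-- ★★ **The comparison sends the `A_max`-period of a torsion sequence to `p^N·∫_v ω` modulo `Fil^k`.** Let `v` be a torsion sequence of
`Ŵ(𝔪_{ℂ_F})` (`v₀ = 0`, `[p]v_{n+1} = v_n`), `[ṽ] ∈ Ŵ(𝔫)` Fontaine's integral, `Λ = Λ_N(ι[ṽ], z) ∈ A_max` its `A_max`-period (`N ≥ 1`, numerators
`formalLogNum W p`, witness `ι[ṽ]^N = p·z`), and `L ∈ B_dR⁺` any limit of `Λ` modulo `Fil^k` (`exists_bdR_lim_modFil`, shift `r`). Then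
**`L − p^N·∫_v ω ∈ ξ^k B_dR⁺`**, `∫_v ω = omegaPeriod W hθ v` the `ξ`-adic `ω`-period of K1. [cite: Fontaine1982FormesDifferentielles, §5]
[cite: Colmez1992PeriodesAbeliennes, §2] [cite: FontaineAsterisque223III, Exp. II §1.5.3] -/
theorem sub_pow_mul_omegaPeriod_mem_of_bdR_lim_modFil_logSum {t : ℕ → (maxNilIdealC F).toIdeal}
    (ht0 : ((t 0 : (maxNilIdealC F).toIdeal) : CBall F) = 0) (htp : ∀ n, mulPC F p W (t (n + 1)) = t n) {N : ℕ} (hN : 1 ≤ N)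
    {z : bmaxZero F p}
    (hz : algebraMap (Ainf (p := p) F) (bmaxZero F p)
        ((AinfTop.of F p).symm (((divisionLiftPt W hθ t htp).val : (nilTheta F p hθ).toIdeal) : AinfTop F p)) ^ N =
      (p : bmaxZero F p) * z)
    {k : ℕ} {L : BDeRhamPlus (integerC F) p} {r : ℕ}
    (hL : ∀ N' M : ℕ, N' + r ≤ M → ∀ y : bmaxZero F p,
      AdicCompletion.evalₐ (Ideal.span {(p : bmaxZero F p)}) M
          (PadicLogSeries.logSum ((algebraMap (Ainf (p := p) F) (bmaxZero F p)).comp zpToAinf) (formalLogNum W p) N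
            (algebraMap (Ainf (p := p) F) (bmaxZero F p)
              ((AinfTop.of F p).symm (((divisionLiftPt W hθ t htp).val : (nilTheta F p hθ).toIdeal) : AinfTop F p))) z) =
        Ideal.Quotient.mk _ y →
      ∃ (a : Ainf (p := p) F) (w : BDeRhamPlus (integerC F) p),
        (p : BDeRhamPlus (integerC F) p) ^ k *
            (L - algebraMap (Localization.Away (p : Ainf (p := p) F)) (BDeRhamPlus (integerC F) p)
              (y : Localization.Away (p : Ainf (p := p) F))) =
          ainfToBdR ((p : Ainf (p := p) F) ^ N' * a) + xiBdR ^ k * w) :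
    L - (p : BDeRhamPlus (integerC F) p) ^ N * (BdRPlusTop.of F p).symm (omegaPeriod W hθ t ht0 htp) ∈
      Ideal.span {(xiBdR : BDeRhamPlus (integerC F) p) ^ k} := by
  obtain ⟨L', hL'eq, hL'⟩ := exists_isFormalLogModFil_of_bdR_lim_modFil_logSum W hN _ hz hL
  have hZ : thetaPt W hθ (divisionLiftPt W hθ t htp) = 0 := thetaPt_divisionLiftPt_eq_zero W ht0 htp
  have hK := isFormalLogModFil_logKer W k (divisionLiftPt W hθ t htp) hZ
  rw [logKer_divisionLiftPt_of_zero W ht0 htp hZ] at hK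
  have hdiff := hL'.sub_mem_span_xiBdR_pow hK
  rw [← hL'eq, ← mul_sub]
  exact Ideal.mul_mem_left _ _ hdiff

end AinfTop

end Literature.NumberTheory.PAdicHodge

end
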